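import Summits.AtomisticToContinuum.HydrodynamicLimit.Theorems.AntiMazurCoboundariesCellForecastPressureDecayKinematicAssemblyCylinder
import Literature.Analysis.FluidPDE.SphereMeasureSymmetry
import Literature.MathematicalPhysics.KineticTheory.HardSphereCrossSection
import Summits.AtomisticToContinuum.HydrodynamicLimit.Theorems.JParityClosureRateFloorGainSpreading
import HarnessLib

/-!
# S2d · kinematic assembly, piece 4: the static pair functional of a slab and the pair kernel
# (registered sub-goal `stub_kinematicAssembly_mainTerm` of stub `stub_kinematicAssembly`, crux line
# `enskog-compensator-martingale`, crux `CellForecastPressureDecay`, stmt-AtomisticToContinuum-13915)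

The MAIN TERM of the equal-time Enskog kinematics (`KinematicRates σ`, stub S2d). By pieces 1–2
(`stub_kinematicAssembly_noCollision`, `stub_kinematicAssembly_freshPair`) the increment `w(vᵢ(Δ)) − w(vᵢ(0))`
summed over the spheres of the fresh pairs of the slab `[0, Δ]` is `∑_{fresh pairs} φᵢⱼ(xᵢ − xⱼ)` for the STATIC
pair functional of the initial relative position
`φ(q) = 1_{Cyl(v − u, Δ)}(q) · [w(v') + w(u') − w(v) − w(u)]`, `(v', u') = reflectVel (σ ω(q)) (v, u)`,
(`Cyl` Boltzmann's collision cylinder, `ω(q)` the impact direction). This file constructs `φ` for every pair of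
velocities `(v, u)` and proves the four properties the pair statistics `ContactStatistics` (S2c) consume:

* `φ` is measurable and `|φ| ≤ 4 sup|w|`;
* `φ` is supported in the contact shell `σ ≤ ‖q‖ ≤ σ + Δ‖v − u‖` (`norm_collisionCylinder_mem`);
* on the cylinder `φ(σ ω − t (v − u))` IS the two-body jump, off it `φ = 0`;
* **`∫ φ(q) dq = σ² Δ · K_w(v, u)` exactly** (`pairKernel` of the line's objects): the Bochner form of the
  cylinder identity for bounded functions of the impact direction (`integral_collisionCylinder_dir`, from the
  `lintegral` identity of piece 3 by shifting to a nonnegative integrand) and the incoming-hemisphere form of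
  the pair kernel (`pairKernel_eq_integral_incoming`: `reflectVel (σ ω) = collide ω`, `collide (−ω) = collide ω`
  (`RateFloorGainSpreading.collide_neg_dir`), antipodal symmetry of the sphere measure);
* `abs_pairKernel_le` — `|K_w(v, u)| ≤ 4 sup|w| · π‖v − u‖` (the collision frequency `∫ ((v − u)·ω)₊ dω = π‖v − u‖`).

References: C. Cercignani, R. Illner, M. Pulvirenti, *The Mathematical Theory of Dilute Gases* (1994), §2.2
(collision cylinders; the Boltzmann–Enskog collision frequency `σ² ∫ ((v − u)·ω)₊ dω = π σ² |v − u|`).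
-/

noncomputable section

open MeasureTheory ProbabilityTheory Set Filter Topology
open scoped ENNReal BigOperators InnerProductSpace
open Literature.Analysis.FluidPDE Literature.MathematicalPhysics.KineticTheory

namespace Summit.AtomisticToContinuum.HydrodynamicLimit.Theorems.EnskogCompensator

/-! ## The two-body jump and the pair kernel of the line -/

/-- At a contact of spheres of diameter `σ ≠ 0` with unit impact direction `ω`, the elastic jump
`reflectVel (σ ω)` of the line's dynamics (`collidePair`) is the kinetic-theory collision map `collide ω`.
[folklore] -/
theorem reflectVel_smul_sphere {σ : ℝ} (hσ : σ ≠ 0) (ω : Metric.sphere (0 : V3) 1) (p : V3 × V3) :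
    reflectVel (σ • (ω : V3)) p = collide ω p := by
  rw [reflectVel_smul hσ, reflectVel_eq_collide]

/-- **The incoming-hemisphere form of the Enskog–Boltzmann pair kernel.** For `σ ≠ 0`,
`K_w(v, u) = ∫_{S²} (⟪ω, v − u⟫)₋ [w(v') + w(u') − w(v) − w(u)] dω` with `(v', u') = reflectVel (σ ω) (v, u)`
the two-body jump of a fresh pair hit at impact vector `σ ω` (`stub_kinematicAssembly_freshPair`): the
definition of `pairKernel` uses the outgoing convention `(⟪v − u, ω⟫)₊` and `collide ω`, and the antipodal
symmetry `ω ↦ −ω` of the sphere measure (`integral_posPart_inner_mul_sphere_eq`) with `collide (−ω) =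
collide ω` passes between the two. [cite: CIP1994, §2.2] -/
theorem pairKernel_eq_integral_incoming (w : V3 → ℝ) (v u : V3) {σ : ℝ} (hσ : σ ≠ 0) :
    pairKernel w v u = ∫ ω : Metric.sphere (0 : V3) 1, max (-⟪(ω : V3), v - u⟫_ℝ) 0 *
      (w (reflectVel (σ • (ω : V3)) (v, u)).1 + w (reflectVel (σ • (ω : V3)) (v, u)).2 - w v - w u)
        ∂sphereMeasure := by
  unfold pairKernel hardSphereKernel
  rw [integral_posPart_inner_mul_sphere_eq]
  refine integral_congr_ae (Eventually.of_forall fun ω => ?_)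
  simp only [reflectVel_smul_sphere hσ, RateFloorGainSpreading.collide_neg_dir, real_inner_comm (v - u)]


/-! ## The cylinder identity for bounded real functions of the impact direction -/

/-- The kinematic weight `(⟪ω, u⟫)₋` has finite sphere integral (it is bounded by `‖u‖`). [folklore] -/
theorem lintegral_negPart_inner_lt_top (u : V3) :
    ∫⁻ ω : Metric.sphere (0 : V3) 1, ENNReal.ofReal (max (-⟪(ω : V3), u⟫_ℝ) 0) ∂sphereMeasure < ⊤ := by
  haveI := isFiniteMeasure_sphereMeasure (E := V3)
  refine lt_of_le_of_lt (lintegral_mono (g := fun _ => ENNReal.ofReal ‖u‖) fun ω => ?_) ?_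
  · refine ENNReal.ofReal_le_ofReal (max_le ?_ (norm_nonneg u))
    have h1 : |⟪(ω : V3), u⟫_ℝ| ≤ ‖(ω : V3)‖ * ‖u‖ := abs_real_inner_le_norm _ _
    have h2 : ‖(ω : V3)‖ = 1 := by simp
    rw [h2, one_mul] at h1
    linarith [neg_abs_le ⟪(ω : V3), u⟫_ℝ]
  · rw [lintegral_const]
    exact ENNReal.mul_lt_top ENNReal.ofReal_lt_top (measure_lt_top _ _)

/-- Boltzmann's collision cylinder of the slab is a measurable set. [folklore] -/
theorem measurableSet_collisionCylinder {σ : ℝ} (hσ : 0 < σ) (u : V3) (Δ : ℝ) :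
    MeasurableSet {q : V3 | ∃ (ω : Metric.sphere (0 : V3) 1) (t : ℝ), t ∈ Ioc 0 Δ ∧ ⟪(ω : V3), u⟫_ℝ < 0 ∧
      q = σ • (ω : V3) - t • u} := by
  rw [← image_cylMap σ u Δ]
  have hne : ∀ p ∈ {p : V3 | ‖p‖ ≤ Δ ∧ ⟪p, u⟫_ℝ < 0}, p ≠ 0 := fun p hp h => by
    have := hp.2; rw [h, inner_zero_left] at this; exact lt_irrefl _ this
  exact measurable_image_of_fderivWithin (measurableSet_cylDomain u Δ)
    (fun p hp => (hasFDerivAt_cylMap σ u (hne p hp)).hasFDerivWithinAt) (injOn_cylMap hσ u Δ)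

/-- The volume of the collision cylinder: `vol(Cyl) = σ² Δ ∫_{S²} (⟪ω, u⟫)₋ dω` (`= π σ² ‖u‖ Δ`). [cite: CIP1994, §2.2] -/
theorem volume_collisionCylinder {σ : ℝ} (hσ : 0 < σ) (u : V3) (Δ : ℝ) :
    volume {q : V3 | ∃ (ω : Metric.sphere (0 : V3) 1) (t : ℝ), t ∈ Ioc 0 Δ ∧ ⟪(ω : V3), u⟫_ℝ < 0 ∧
      q = σ • (ω : V3) - t • u} =
      ENNReal.ofReal (σ ^ 2 * Δ) * ∫⁻ ω : Metric.sphere (0 : V3) 1, ENNReal.ofReal (max (-⟪(ω : V3), u⟫_ℝ) 0)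
        ∂sphereMeasure := by
  have h := stub_kinematicAssembly_cylinder σ Δ u (fun _ => 1) hσ measurable_const
  simp only [mul_one, setLIntegral_one] at h
  exact h

/-- The impact direction `ω(q) = σ⁻¹ (q + τ(q) u)` is a measurable function of the relative position. [folklore] -/
theorem measurable_impactDir (σ : ℝ) (u : V3) :
    Measurable fun q : V3 => σ⁻¹ • (q + pairHitTime σ q u • u) :=
  (measurable_id.add ((measurable_pairHitTime σ u).smul measurable_const)).const_smul σ⁻¹

/-- **The cylinder identity for bounded real functions of the impact direction** (Bochner form of
`stub_kinematicAssembly_cylinder`): for measurable `g` with `|g| ≤ M` and `Δ ≥ 0`,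
`∫_{Cyl} g(ω(q)) dq = σ² Δ ∫_{S²} (⟪ω, u⟫)₋ g(ω) dω`. [cite: CIP1994, §2.2] -/
theorem integral_collisionCylinder_dir {σ Δ M : ℝ} (hσ : 0 < σ) (hΔ : 0 ≤ Δ) (u : V3) (g : V3 → ℝ)
    (hg : Measurable g) (hgM : ∀ x, |g x| ≤ M) :
    ∫ q in {q : V3 | ∃ (ω : Metric.sphere (0 : V3) 1) (t : ℝ), t ∈ Ioc 0 Δ ∧ ⟪(ω : V3), u⟫_ℝ < 0 ∧
        q = σ • (ω : V3) - t • u}, g (σ⁻¹ • (q + pairHitTime σ q u • u)) =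
      σ ^ 2 * Δ * ∫ ω : Metric.sphere (0 : V3) 1, max (-⟪(ω : V3), u⟫_ℝ) 0 * g (ω : V3) ∂sphereMeasure := by
  haveI := isFiniteMeasure_sphereMeasure (E := V3)
  set C : Set V3 := {q : V3 | ∃ (ω : Metric.sphere (0 : V3) 1) (t : ℝ), t ∈ Ioc 0 Δ ∧ ⟪(ω : V3), u⟫_ℝ < 0 ∧
    q = σ • (ω : V3) - t • u} with hC
  set dir : V3 → V3 := fun q => σ⁻¹ • (q + pairHitTime σ q u • u) with hdir
  set k : Metric.sphere (0 : V3) 1 → ℝ := fun ω => max (-⟪(ω : V3), u⟫_ℝ) 0 with hk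
  have hM : 0 ≤ M := (abs_nonneg _).trans (hgM 0)
  have hσΔ : 0 ≤ σ ^ 2 * Δ := mul_nonneg (sq_nonneg σ) hΔ
  have hCm : MeasurableSet C := measurableSet_collisionCylinder hσ u Δ
  have hdirm : Measurable dir := measurable_impactDir σ u
  have hk0 : ∀ ω, 0 ≤ k ω := fun ω => le_max_right _ _
  have hkm : Measurable k :=
    ((continuous_subtype_val.inner continuous_const).neg.max continuous_const).measurable
  have hku : ∀ ω, k ω ≤ ‖u‖ := fun ω => by
    refine max_le ?_ (norm_nonneg u)
    have h1 : |⟪(ω : V3), u⟫_ℝ| ≤ ‖(ω : V3)‖ * ‖u‖ := abs_real_inner_le_norm _ _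
    have h2 : ‖(ω : V3)‖ = 1 := by simp
    rw [h2, one_mul] at h1
    linarith [neg_abs_le ⟪(ω : V3), u⟫_ℝ]
  -- the kinematic weight: its lintegral is the Bochner integral
  have hklin : ∫⁻ ω, ENNReal.ofReal (k ω) ∂sphereMeasure = ENNReal.ofReal (∫ ω, k ω ∂sphereMeasure) := by
    rw [← ofReal_integral_eq_lintegral_ofReal (Integrable.of_bound hkm.aestronglyMeasurable ‖u‖
      (Eventually.of_forall fun ω => by rw [Real.norm_of_nonneg (hk0 ω)]; exact hku ω))
      (Eventually.of_forall hk0)]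
  have hkint : Integrable k sphereMeasure := Integrable.of_bound hkm.aestronglyMeasurable ‖u‖
    (Eventually.of_forall fun ω => by rw [Real.norm_of_nonneg (hk0 ω)]; exact hku ω)
  have hkgint : Integrable (fun ω => k ω * g (ω : V3)) sphereMeasure :=
    Integrable.of_bound (hkm.mul (hg.comp measurable_subtype_coe)).aestronglyMeasurable (‖u‖ * M)
      (Eventually.of_forall fun ω => by
        rw [Real.norm_eq_abs, abs_mul, abs_of_nonneg (hk0 ω)]
        exact mul_le_mul (hku ω) (hgM _) (abs_nonneg _) (norm_nonneg _))
  -- the volume of the cylinder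
  have hvol : volume C = ENNReal.ofReal (σ ^ 2 * Δ) * ENNReal.ofReal (∫ ω, k ω ∂sphereMeasure) := by
    rw [hC, volume_collisionCylinder hσ u Δ, ← hklin]
  have hvol' : (volume C).toReal = σ ^ 2 * Δ * ∫ ω, k ω ∂sphereMeasure := by
    rw [hvol, ENNReal.toReal_mul, ENNReal.toReal_ofReal hσΔ, ENNReal.toReal_ofReal (integral_nonneg hk0)]
  have hvol_lt : volume C < ⊤ := by rw [hvol]; exact ENNReal.mul_lt_top ENNReal.ofReal_lt_top ENNReal.ofReal_lt_top
  -- shift `g` to a nonnegative function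
  set G : V3 → ℝ := fun q => g (dir q) + M with hG
  have hG0 : ∀ q, 0 ≤ G q := fun q => by have := hgM (dir q); rw [abs_le] at this; simp only [hG]; linarith
  have hGm : Measurable G := (hg.comp hdirm).add measurable_const
  have hGint : IntegrableOn G C volume := IntegrableOn.of_bound hvol_lt hGm.aestronglyMeasurable (2 * M)
    (Eventually.of_forall fun q => by
      rw [Real.norm_of_nonneg (hG0 q)]
      have := hgM (dir q); rw [abs_le] at this; simp only [hG]; linarith)
  have hcint : IntegrableOn (fun _ : V3 => M) C volume := integrableOn_const hvol_lt.ne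
  -- Step 1: `∫_C g ∘ dir = ∫_C G − M vol(C)`
  have step1 : ∫ q in C, g (dir q) = (∫ q in C, G q) - M * (σ ^ 2 * Δ * ∫ ω, k ω ∂sphereMeasure) := by
    have : (fun q => g (dir q)) = fun q => G q - M := by funext q; simp [hG]
    rw [this, integral_sub hGint hcint, setIntegral_const, smul_eq_mul, measureReal_def, hvol', mul_comm]
  -- Step 2: `∫_C G` by the cylinder identity
  have step2 : ∫ q in C, G q = σ ^ 2 * Δ * ∫ ω, k ω * (g (ω : V3) + M) ∂sphereMeasure := by
    rw [integral_eq_lintegral_of_nonneg_ae (Eventually.of_forall hG0) hGm.aestronglyMeasurable]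
    have hcyl := stub_kinematicAssembly_cylinder σ Δ u (fun x => ENNReal.ofReal (g x + M)) hσ
      (hg.add measurable_const).ennreal_ofReal
    have hlhs : ∫⁻ q in C, ENNReal.ofReal (G q) = ∫⁻ q in C, ENNReal.ofReal (g (σ⁻¹ • (q + pairHitTime σ q u • u)) + M) := rfl
    rw [hlhs, hcyl]
    have hprod : ∀ ω : Metric.sphere (0 : V3) 1, ENNReal.ofReal (max (-⟪(ω : V3), u⟫_ℝ) 0) *
        ENNReal.ofReal (g (ω : V3) + M) = ENNReal.ofReal (k ω * (g (ω : V3) + M)) := fun ω => by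
      rw [← ENNReal.ofReal_mul (hk0 ω)]
    simp_rw [hprod]
    have hH0 : ∀ ω, 0 ≤ k ω * (g (ω : V3) + M) := fun ω =>
      mul_nonneg (hk0 ω) (by have := hgM (ω : V3); rw [abs_le] at this; linarith)
    have hHm : Measurable fun ω => k ω * (g (ω : V3) + M) :=
      hkm.mul ((hg.comp measurable_subtype_coe).add measurable_const)
    rw [← ofReal_integral_eq_lintegral_ofReal (Integrable.of_bound hHm.aestronglyMeasurable (‖u‖ * (2 * M))
      (Eventually.of_forall fun ω => by
        rw [Real.norm_of_nonneg (hH0 ω)]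
        refine mul_le_mul (hku ω) ?_ (by have := hgM (ω : V3); rw [abs_le] at this; linarith) (norm_nonneg _)
        have := hgM (ω : V3); rw [abs_le] at this; linarith)) (Eventually.of_forall hH0),
      ENNReal.toReal_mul, ENNReal.toReal_ofReal hσΔ, ENNReal.toReal_ofReal (integral_nonneg hH0)]
  -- Step 3: combine
  have step3 : ∫ ω, k ω * (g (ω : V3) + M) ∂sphereMeasure =
      (∫ ω, k ω * g (ω : V3) ∂sphereMeasure) + M * ∫ ω, k ω ∂sphereMeasure := by
    have : (fun ω => k ω * (g (ω : V3) + M)) = fun ω => k ω * g (ω : V3) + M * k ω := by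
      funext ω; ring
    rw [this, integral_add hkgint (hkint.const_mul M), integral_const_mul]
  rw [step1, step2, step3]
  ring


/-! ## The main term of the kinematic assembly: the static pair functional of a slab -/

/-- The elastic jump as a function of the impact vector is measurable. [folklore] -/
theorem measurable_reflectVel_smul (σ : ℝ) (v u : V3) :
    Measurable fun x : V3 => reflectVel (σ • x) (v, u) := by
  unfold reflectVel
  have hc : Measurable fun x : V3 => ⟪v - u, σ • x⟫_ℝ / ‖σ • x‖ ^ 2 :=
    (measurable_const.inner (measurable_id.const_smul σ)).div ((measurable_id.const_smul σ).norm.pow_const 2)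
  exact (measurable_const.sub (hc.smul (measurable_id.const_smul σ))).prodMk
    (measurable_const.add (hc.smul (measurable_id.const_smul σ)))

/-- The two-body jump `J(x) = w(v') + w(u') − w(v) − w(u)`, `(v', u') = reflectVel (σ x) (v, u)`, is a measurable
function of the impact direction. [folklore] -/
theorem measurable_twoBodyJump (σ : ℝ) {w : V3 → ℝ} (hw : Measurable w) (v u : V3) :
    Measurable fun x : V3 => w (reflectVel (σ • x) (v, u)).1 + w (reflectVel (σ • x) (v, u)).2 - w v - w u :=
  (((hw.comp (measurable_reflectVel_smul σ v u).fst).add (hw.comp (measurable_reflectVel_smul σ v u).snd)).sub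
    measurable_const).sub measurable_const

/-- A four-point combination `w(a) + w(c) − w(v) − w(u)` of a function bounded by `b` is bounded by `4b` (the
two-body jump of `w`). [folklore] -/
theorem abs_fourPoint_le {w : V3 → ℝ} {b : ℝ} (hwb : ∀ x, |w x| ≤ b) (a c v u : V3) :
    |w a + w c - w v - w u| ≤ 4 * b := by
  have h1 := hwb a
  have h2 := hwb c
  have h3 := hwb v
  have h4 := hwb u
  calc |w a + w c - w v - w u| ≤ |w a + w c - w v| + |w u| := abs_sub _ _
    _ ≤ |w a + w c| + |w v| + |w u| := by linarith [abs_sub (w a + w c) (w v)]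
    _ ≤ |w a| + |w c| + |w v| + |w u| := by linarith [abs_add_le (w a) (w c)]
    _ ≤ 4 * b := by linarith

/-- **The pair kernel is bounded by the collision frequency**: `|K_w(v, u)| ≤ 4 sup|w| · π ‖v − u‖`
(`∫_{S²} ((v − u)·ω)₊ dω = π ‖v − u‖`). [cite: CIP1994, §3.1] -/
theorem abs_pairKernel_le {w : V3 → ℝ} {b : ℝ} (hwb : ∀ x, |w x| ≤ b) (v u : V3) :
    |pairKernel w v u| ≤ 4 * b * (Real.pi * ‖v - u‖) := by
  haveI := isFiniteMeasure_sphereMeasure (E := V3)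
  have hK0 : ∀ ω : Metric.sphere (0 : V3) 1, 0 ≤ hardSphereKernel (v, u) ω := fun ω => le_max_right _ _
  have hKle : ∀ ω : Metric.sphere (0 : V3) 1, hardSphereKernel (v, u) ω ≤ ‖v - u‖ := fun ω => by
    refine max_le ?_ (norm_nonneg _)
    have h1 : |⟪v - u, (ω : V3)⟫_ℝ| ≤ ‖v - u‖ * ‖(ω : V3)‖ := abs_real_inner_le_norm _ _
    have h2 : ‖(ω : V3)‖ = 1 := by simp
    rw [h2, mul_one] at h1
    exact (le_abs_self _).trans h1
  have hKm : Measurable fun ω : Metric.sphere (0 : V3) 1 => hardSphereKernel (v, u) ω := by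
    unfold hardSphereKernel
    exact ((continuous_const.inner continuous_subtype_val).max continuous_const).measurable
  have hKint : Integrable (fun ω => hardSphereKernel (v, u) ω) sphereMeasure :=
    Integrable.of_bound hKm.aestronglyMeasurable ‖v - u‖
      (Eventually.of_forall fun ω => by rw [Real.norm_of_nonneg (hK0 ω)]; exact hKle ω)
  rw [← Real.norm_eq_abs, pairKernel, ← integral_hardSphereKernel_eq_pi_mul_norm, ← integral_const_mul]
  refine norm_integral_le_of_norm_le (hKint.const_mul _) (Eventually.of_forall fun ω => ?_)
  rw [Real.norm_eq_abs, abs_mul, abs_of_nonneg (hK0 ω), mul_comm (4 * b)]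
  exact mul_le_mul_of_nonneg_left (abs_fourPoint_le hwb _ _ _ _) (hK0 ω)

/-- **Points of the collision cylinder lie in the contact shell** `σ ≤ ‖q‖ ≤ σ + Δ ‖u‖`: before the hit the
pair is separated (`‖σ ω − t u‖² = σ² − 2σt⟪ω, u⟫ + t²‖u‖² ≥ σ²` for incoming `ω`). [cite: CIP1994, §2.2] -/
theorem norm_collisionCylinder_mem {σ Δ : ℝ} (hσ : 0 < σ) (u : V3) (ω : Metric.sphere (0 : V3) 1) {t : ℝ}
    (ht : t ∈ Ioc 0 Δ) (hωu : ⟪(ω : V3), u⟫_ℝ < 0) :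
    σ ≤ ‖σ • (ω : V3) - t • u‖ ∧ ‖σ • (ω : V3) - t • u‖ ≤ σ + Δ * ‖u‖ := by
  have hω : ‖(ω : V3)‖ = 1 := by simp
  constructor
  · have hsq : σ ^ 2 ≤ ‖σ • (ω : V3) - t • u‖ ^ 2 := by
      rw [norm_sub_sq_real, norm_smul, hω, mul_one, Real.norm_of_nonneg hσ.le, inner_smul_left,
        inner_smul_right, RCLike.conj_to_real]
      have h1 : σ * (t * ⟪(ω : V3), u⟫_ℝ) ≤ 0 :=
        mul_nonpos_of_nonneg_of_nonpos hσ.le (mul_nonpos_of_nonneg_of_nonpos ht.1.le hωu.le)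
      nlinarith [sq_nonneg ‖t • u‖]
    exact le_of_pow_le_pow_left₀ two_ne_zero (norm_nonneg _) hsq
  · calc ‖σ • (ω : V3) - t • u‖ ≤ ‖σ • (ω : V3)‖ + ‖t • u‖ := norm_sub_le _ _
      _ = σ + t * ‖u‖ := by rw [norm_smul, norm_smul, hω, mul_one, Real.norm_of_nonneg hσ.le,
          Real.norm_of_nonneg ht.1.le]
      _ ≤ σ + Δ * ‖u‖ := by gcongr; exact ht.2

/-- **Registered sub-goal `stub_kinematicAssembly_mainTerm`** (piece of stub `stub_kinematicAssembly`, S2d, of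
the line `enskog-compensator-martingale`): **the static pair functional of a slab and its exact integral.**
For `σ > 0`, `Δ ≥ 0`, a measurable `w` with `|w| ≤ b` and a pair of velocities `(v, u)`, the function
`φ(q) = 1_{Cyl(v − u, Δ)}(q) · [w(v') + w(u') − w(v) − w(u)]` of the relative position `q` — the two-body jump
of the pair IF it is fresh and hits within the slab (`stub_kinematicAssembly_freshPair`: then `q = σ ω − t (v − u)`
and `(v', u') = reflectVel (σ ω) (v, u)`), ELSE `0` — is measurable, bounded by `4b`, supported in the contact
shell `σ ≤ ‖q‖ ≤ σ + Δ ‖v − u‖` (the hypotheses of the pair statistics `ContactStatistics`, S2c, with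
`r = Δ ‖v − u‖`), and its Lebesgue integral is EXACTLY `σ² Δ K_w(v, u)` with the line's Enskog–Boltzmann pair
kernel `pairKernel` (cylinder identity `stub_kinematicAssembly_cylinder` + `pairKernel_eq_integral_incoming`).
[cite: CIP1994, §2.2] -/
theorem stub_kinematicAssembly_mainTerm : ∀ (σ Δ b : ℝ) (w : V3 → ℝ) (v u : V3), 0 < σ → 0 ≤ Δ → Measurable w →
    (∀ x, |w x| ≤ b) →
      ∃ φ : V3 → ℝ, Measurable φ ∧ (∀ q, |φ q| ≤ 4 * b) ∧
        (∀ q, φ q ≠ 0 → σ ≤ ‖q‖ ∧ ‖q‖ ≤ σ + Δ * ‖v - u‖) ∧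
        (∀ (ω : Metric.sphere (0 : V3) 1) (t : ℝ), t ∈ Set.Ioc 0 Δ → inner ℝ (ω : V3) (v - u) < 0 →
          φ (σ • (ω : V3) - t • (v - u)) =
            w (reflectVel (σ • (ω : V3)) (v, u)).1 + w (reflectVel (σ • (ω : V3)) (v, u)).2 - w v - w u) ∧
        (∀ q, (¬ ∃ (ω : Metric.sphere (0 : V3) 1) (t : ℝ), t ∈ Set.Ioc 0 Δ ∧ inner ℝ (ω : V3) (v - u) < 0 ∧
          q = σ • (ω : V3) - t • (v - u)) → φ q = 0) ∧
        ∫ q, φ q = σ ^ 2 * Δ * pairKernel w v u := by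
  intro σ Δ b w v u hσ hΔ hw hwb
  set C : Set V3 := {q : V3 | ∃ (ω : Metric.sphere (0 : V3) 1) (t : ℝ), t ∈ Ioc 0 Δ ∧
    ⟪(ω : V3), v - u⟫_ℝ < 0 ∧ q = σ • (ω : V3) - t • (v - u)} with hC
  set J : V3 → ℝ := fun x => w (reflectVel (σ • x) (v, u)).1 + w (reflectVel (σ • x) (v, u)).2 - w v - w u
    with hJ
  set dir : V3 → V3 := fun q => σ⁻¹ • (q + pairHitTime σ q (v - u) • (v - u)) with hdir
  have hCm : MeasurableSet C := measurableSet_collisionCylinder hσ (v - u) Δ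
  have hJm : Measurable J := measurable_twoBodyJump σ hw v u
  have hJb : ∀ x, |J x| ≤ 4 * b := fun x => abs_fourPoint_le hwb _ _ v u
  have hdirC : ∀ (ω : Metric.sphere (0 : V3) 1) (t : ℝ), t ∈ Ioc 0 Δ → ⟪(ω : V3), v - u⟫_ℝ < 0 →
      dir (σ • (ω : V3) - t • (v - u)) = (ω : V3) := fun ω t ht hωu => by
    simp only [hdir]
    rw [(collisionCylinder_pairHits hσ (v - u) ω ht.1 hωu).2, sub_add_cancel, smul_smul,
      inv_mul_cancel₀ hσ.ne', one_smul]
  refine ⟨C.indicator fun q => J (dir q), (hJm.comp (measurable_impactDir σ (v - u))).indicator hCm,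
    fun q => ?_, fun q hq => ?_, fun ω t ht hωu => ?_, fun q hq => ?_, ?_⟩
  · by_cases hq : q ∈ C
    · rw [indicator_of_mem hq]; exact hJb _
    · rw [indicator_of_notMem hq, abs_zero]; linarith [(abs_nonneg _).trans (hwb 0)]
  · have hqC : q ∈ C := by
      by_contra h
      exact hq (indicator_of_notMem h _)
    obtain ⟨ω, t, ht, hωu, rfl⟩ := hqC
    exact norm_collisionCylinder_mem hσ (v - u) ω ht hωu
  · rw [indicator_of_mem (show σ • (ω : V3) - t • (v - u) ∈ C from ⟨ω, t, ht, hωu, rfl⟩)]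
    simp only [hJ, hdirC ω t ht hωu]
  · have hq' : q ∉ C := hq
    exact indicator_of_notMem hq' (fun q => J (dir q))
  · rw [integral_indicator hCm, integral_collisionCylinder_dir hσ hΔ (v - u) J hJm hJb,
      pairKernel_eq_integral_incoming w v u hσ.ne']

end Summit.AtomisticToContinuum.HydrodynamicLimit.Theorems.EnskogCompensator

end
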